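import Mathlib
import HarnessLib

/-!
# The Cramér–Wold device for replica vectors: convergence in distribution of every fixed linear combination `Σ_r t_r V_{n,r}` gives convergence of the vector `(V_{n,r})_r` in `EuclideanSpace ℝ ι`

HONEST FRAMING: exact (Metropolis-corrected) sampling algorithms for lattice gauge theory;
figures of merit are autocorrelation/cost numbers at stated couplings and volumes; no
continuum-physics claim.

Venture `LatticeQCDFlow` (cell pub-lqcd), topic `Exactness`; FANOUT row 13 (`eng-snf`, GEN-24).  NEW
WORK of the cell against Mathlib only (Lévy's continuity theorem
`ProbabilityMeasure.tendsto_iff_tendsto_charFun`, `charFun_apply`, `PiLp.inner_apply`); not a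
published result (the Cramér–Wold theorem, 1936, NAMED ONLY); no definition is introduced.

WHY (row 13).  GEN-23 Jg (`NCMCGeneralSpaceReplicaVectorCLT`) obtains the joint Gaussian limit of a
replica vector from INDEPENDENCE of the coordinates (`charFun_pi`).  For replicas with DEPENDENT
starts (GEN-24 `NCMCGeneralSpaceReplicaProductChainPooledCLT`: the product chain from an arbitrary
joint initial law) the coordinates of `V_n = (√n (ȳ_{r,n} − πf))_r` are not independent at any finite
`n`; what IS available is the CLT of every fixed linear combination `Σ_r t_r V_{n,r}` (a time average of
the bounded observable `Σ_r t_r f ∘ eval_r` along the product chain).  This file supplies the device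
that turns those one-dimensional limits into the vector limit, after which GEN-23 K / K3
(`tendstoInDistribution_tStat_of_pi_gaussianReal`, `tendsto_measure_abs_tStat_le_of_pi_gaussianReal`)
deliver the replica-`t` statistic's limit law and coverage exactly as for independent replicas.

## Content
* `charFun_map_toLp_eq_charFun_map_sum_mul` (§1) — for `V : Ω → ι → ℝ` measurable and
  `t ∈ EuclideanSpace ℝ ι`: the characteristic function of the law of `toLp 2 ∘ V` at `t` is the
  characteristic function of the law of the real variable `ω ↦ Σ_r t_r V(ω)_r` at `1`.
* **`tendstoInDistribution_toLp_of_forall_sum_mul`** (§2) — CRAMÉR–WOLD: if for every `t : ι → ℝ`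
  the real variables `Σ_r t_r V_{n,r}` converge in distribution (under `P_n`) to `Σ_r t_r Z_r` (under
  `μ`), then `toLp 2 ∘ V_n ⇒ toLp 2 ∘ Z` in `EuclideanSpace ℝ ι`.
* **`tendstoInDistribution_toLp_pi_gaussianReal_of_forall_sum_mul`** (§2) — the Gaussian target:
  if `Σ_r t_r V_{n,r} ⇒ N(0, (Σ_r t_r²) v)` for every `t`, then `V_n ⇒ N(0, v)^{⊗ι}`.

NOT CLAIMED: the converse direction; non-Euclidean targets; rates.
-/

namespace Summit.Ventures.LatticeQCDFlow.Exactness.GeneralNCMC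

open MeasureTheory ProbabilityTheory Set Filter Topology Finset WithLp Complex
open scoped ENNReal NNReal Topology RealInnerProductSpace

section CramerWold

variable {ι : Type*} [Fintype ι]
  {Ω₀ : Type*} [MeasurableSpace Ω₀]

/-- The characteristic function of the law of a random vector at `t` is the characteristic function
of the law of the linear combination `Σ_r t_r V_r` at `1`. -/
theorem charFun_map_toLp_eq_charFun_map_sum_mul (P : Measure Ω₀) [IsProbabilityMeasure P]
    {V : Ω₀ → ι → ℝ} (hV : Measurable V) (t : PiLp 2 (fun _ : ι => ℝ)) :
    charFun (P.map fun ω => toLp 2 (V ω)) t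
      = charFun (P.map fun ω => ∑ r, t r * V ω r) 1 := by
  have hm : Measurable fun ω => toLp 2 (V ω) := (MeasurableEquiv.toLp 2 (ι → ℝ)).measurable.comp hV
  have hs : Measurable fun ω => ∑ r, t r * V ω r :=
    Finset.measurable_sum _ fun r _ => ((measurable_pi_apply r).comp hV).const_mul _
  rw [charFun_apply, integral_map hm.aemeasurable (by fun_prop), charFun_apply,
    integral_map hs.aemeasurable (by fun_prop)]
  refine integral_congr_ae (Eventually.of_forall fun ω => ?_)
  simp only [PiLp.inner_apply, RCLike.inner_apply, conj_trivial]
  congr 2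
  push_cast
  rw [one_mul]

variable {P : ℕ → Measure Ω₀} [∀ n, IsProbabilityMeasure (P n)]
  {Ω' : Type*} [MeasurableSpace Ω'] {μ : Measure Ω'} [IsProbabilityMeasure μ]

/-- **CRAMÉR–WOLD.**  `V_n : Ω₀ → ι → ℝ`, `Z : Ω' → ι → ℝ` measurable; if for every `t : ι → ℝ` the
linear combinations converge in distribution, `Σ_r t_r V_{n,r} ⇒ Σ_r t_r Z_r`, then the vectors
converge in distribution in `EuclideanSpace ℝ ι`: `toLp 2 ∘ V_n ⇒ toLp 2 ∘ Z`. -/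
theorem tendstoInDistribution_toLp_of_forall_sum_mul {V : ℕ → Ω₀ → ι → ℝ}
    (hV : ∀ n, Measurable (V n)) {Z : Ω' → ι → ℝ} (hZ : Measurable Z)
    (h : ∀ t : ι → ℝ, TendstoInDistribution (fun n ω => ∑ r, t r * V n ω r) atTop
      (fun ω' => ∑ r, t r * Z ω' r) P μ) :
    TendstoInDistribution (fun n ω => toLp 2 (V n ω)) atTop (fun ω' => toLp 2 (Z ω')) P μ := by
  have hm : ∀ n, Measurable fun ω => toLp 2 (V n ω) := fun n =>
    (MeasurableEquiv.toLp 2 (ι → ℝ)).measurable.comp (hV n)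
  have hmZ : Measurable fun ω' => toLp 2 (Z ω') := (MeasurableEquiv.toLp 2 (ι → ℝ)).measurable.comp hZ
  refine ⟨fun n => (hm n).aemeasurable, hmZ.aemeasurable, ?_⟩
  refine ProbabilityMeasure.tendsto_iff_tendsto_charFun.2 fun t => ?_
  simp only [ProbabilityMeasure.coe_mk]
  rw [charFun_map_toLp_eq_charFun_map_sum_mul μ hZ t]
  simp_rw [charFun_map_toLp_eq_charFun_map_sum_mul (P _) (hV _) t]
  have ht := (ProbabilityMeasure.tendsto_iff_tendsto_charFun.1 (h (fun r => t r)).tendsto) 1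
  simp only [ProbabilityMeasure.coe_mk] at ht
  exact ht

/-- **The Gaussian target**: if `Σ_r t_r V_{n,r} ⇒ N(0, (Σ_r t_r²)·v)` (against `id`) for every
`t : ι → ℝ`, then `toLp 2 ∘ V_n ⇒ N(0, v)^{⊗ι}` (canonical variable `toLp 2` on `(ι → ℝ, ⊗N(0,v))`). -/
theorem tendstoInDistribution_toLp_pi_gaussianReal_of_forall_sum_mul {V : ℕ → Ω₀ → ι → ℝ}
    (hV : ∀ n, Measurable (V n)) {v : ℝ≥0}
    (h : ∀ t : ι → ℝ, TendstoInDistribution (fun n ω => ∑ r, t r * V n ω r) atTop id P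
      (gaussianReal 0 (NNReal.mk (∑ r, t r ^ 2) (sum_nonneg fun _ _ => sq_nonneg _) * v))) :
    TendstoInDistribution (fun n ω => toLp 2 (V n ω)) atTop (toLp 2) P
      (Measure.pi fun _ : ι => gaussianReal 0 v) := by
  refine tendstoInDistribution_toLp_of_forall_sum_mul hV measurable_id fun t => ?_
  -- the law of `z ↦ Σ_r t_r z_r` under `⊗N(0,v)` is `N(0, (Σ t_r²) v)`: compare characteristic functions
  have ht := h t
  refine ⟨ht.forall_aemeasurable, (Finset.measurable_sum _ fun r _ =>
    (measurable_pi_apply r).const_mul _).aemeasurable, ?_⟩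
  have hlaw : (Measure.pi fun _ : ι => gaussianReal 0 v).map (fun z : ι → ℝ => ∑ r, t r * z r)
      = gaussianReal 0 (NNReal.mk (∑ r, t r ^ 2) (sum_nonneg fun _ _ => sq_nonneg _) * v) := by
    apply Measure.ext_of_charFun
    funext u
    have hV0 : Measurable fun z : ι → ℝ => z := measurable_id
    have key := charFun_map_toLp_eq_charFun_map_sum_mul (Measure.pi fun _ : ι => gaussianReal 0 v)
      (V := fun z : ι → ℝ => z) hV0 (toLp 2 fun r => u * t r)
    -- left side of `key` is the product-Gaussian vector's charFun at `u • t`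
    rw [show (fun ω : ι → ℝ => toLp 2 ((fun z : ι → ℝ => z) ω)) = toLp 2 from rfl, charFun_pi] at key
    have hsum : (fun ω : ι → ℝ => ∑ r, u * t r * ω r) = fun ω => u * ∑ r, t r * ω r := by
      funext ω; rw [Finset.mul_sum]; exact Finset.sum_congr rfl fun r _ => by ring
    rw [hsum] at key
    -- `charFun (law of u·S) 1 = charFun (law of S) u`
    have hscale : charFun ((Measure.pi fun _ : ι => gaussianReal 0 v).map
        (fun ω : ι → ℝ => u * ∑ r, t r * ω r)) 1
        = charFun ((Measure.pi fun _ : ι => gaussianReal 0 v).map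
          (fun ω : ι → ℝ => ∑ r, t r * ω r)) u := by
      have hms : Measurable fun ω : ι → ℝ => ∑ r, t r * ω r :=
        Finset.measurable_sum _ fun r _ => (measurable_pi_apply r).const_mul _
      rw [charFun_apply, charFun_apply, integral_map (hms.const_mul u).aemeasurable (by fun_prop),
        integral_map hms.aemeasurable (by fun_prop)]
      refine integral_congr_ae (Eventually.of_forall fun ω => ?_)
      simp only [RCLike.inner_apply, conj_trivial]
      congr 2
      push_cast
      ring
    rw [hscale] at key
    rw [← key, charFun_gaussianReal]
    simp only [charFun_gaussianReal, Complex.ofReal_zero, mul_zero, zero_mul, zero_sub,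
      ← Complex.exp_sum]
    congr 1
    push_cast
    rw [Finset.sum_mul, Finset.sum_mul, Finset.sum_div, ← Finset.sum_neg_distrib]
    exact Finset.sum_congr rfl fun r _ => by ring
  have hid : (gaussianReal 0 (NNReal.mk (∑ r, t r ^ 2) (sum_nonneg fun _ _ => sq_nonneg _) * v)).map id
      = (Measure.pi fun _ : ι => gaussianReal 0 v).map (fun z : ι → ℝ => ∑ r, t r * id z r) := by
    rw [Measure.map_id]; exact hlaw.symm
  have htt := ht.tendsto
  simp only [hid] at htt ⊢
  exact htt

end CramerWold

end Summit.Ventures.LatticeQCDFlow.Exactness.GeneralNCMC
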